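import Mathlib
import Summits.Schanuel.Schanuel.Theses.RigidCore
import Summits.Schanuel.Schanuel.Theorems.RigidCoreMinimalCounterexampleInAclLogSector
import Summits.Schanuel.Schanuel.Theorems.RigidCoreMinimalCounterexampleInAclAclCriterion
import Summits.Schanuel.Schanuel.Theorems.RigidCoreMinimalCounterexampleInAclSelectorOneSided
import Summits.Schanuel.Schanuel.Theorems.RigidCoreMinimalCounterexampleInAclSelectorWindow
import Summits.Schanuel.Schanuel.Theorems.RigidCoreMinimalCounterexampleInAclMixedBridge

/-!
# Mixed directions of (S*) at EVERY rank — crux stmt-Schanuel-0969 `RigidCore.MinimalCounterexampleInAcl`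

Line `kernel-arithmetic-selection` (lead prover-line-stmt-Schanuel-0969-c5-0), `--supports stmt-Schanuel-0969`; infrastructure for the
registered stub `stub_geThree` (= item stmt-Schanuel-14744, (S*) in the ranks `n ≥ 3`).

The rank-2 mixed-sector theorem (`stub_rankTwo_mixedSector`, Theorems/…MixedSector.lean) has four ingredients: the BRIDGE (the value
set `E_M = {Σ Mᵢx'ᵢ : x' ∈ locusMates x}` of an integer combination with `e^{Σ Mᵢxᵢ}` algebraic is `∅`-definable and has finitely many
exponentials), the ONE-SIDED and WINDOW SELECTORS (pure statements about an `∅`-definable `E ⊆ ℂ` with `exp '' E` finite), the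
acl-FIELD CRITERION (`n − 1` independent integer combinations of a first failure in `acl(∅)` force every coordinate into `acl(∅)`, by
`SchanuelRank (n − 1)`), and WINDOW-RECURRENCE FINITENESS (long windows of hits recur at finitely many places — the only ingredient whose
proof is specific to curves).  This file records that the first three compose at EVERY rank:

* `intCombo_mem_expAcl_of_oneSided` — a MIXED DIRECTION `M` (`e^{Σ Mᵢxᵢ} ∈ ℚ̄`) of any ℚ-linearly independent tuple `x` whose hit set
  `{k ∈ ℤ : Σ Mᵢxᵢ + 2πik ∈ E_M}` is bounded on one side has `Σ Mᵢxᵢ ∈ acl(∅)`;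
* `intCombo_mem_expAcl_of_windowRecurrence` — the same conclusion when, instead, windows of hits of some length recur at finitely many
  places (verbatim the shape of `windowRecurrence_e0` at rank 2), by the case split "hit set finite ⇒ one-sided selector; infinite ⇒ it
  contains a long window, window selector";
* `intCombo_mem_expAcl_or_hits_unbounded` — the dichotomy: a mixed direction is in `acl(∅)` unless its hit set is unbounded above AND below;
* `mem_expAcl_of_corankOne_oneSided` / `mem_expAcl_of_corankOne_windowRecurrence` — on the CORANK-ONE MIXED SECTOR of rank `n = m + 1`
  (`m` ℚ-independent integer combinations with algebraic exponentials) (S*) holds at `x` as soon as each of the `m` hit sets is one-sided,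
  resp. each direction has finite window recurrence.

So at every rank the mixed sectors of item 14744 reduce to window-recurrence finiteness of the hit sets (card `window-cells` of 14744's
ideation); nothing else of the rank-2 mechanism depends on the rank.  All proofs are compositions of landed theorems of this line.

References: [KirbyMacintyreOnshuus2012] J. Kirby, A. Macintyre, A. Onshuus, *The algebraic numbers definable in various exponential
fields*, J. Inst. Math. Jussieu 11 (2012), arXiv:1101.4224, §2 (`ℤ`, `±2πi` are `∅`-definable); [Kirby2010] J. Kirby, *Exponential
algebraicity in exponential fields*, Bull. LMS 42 (2010), arXiv:0810.4285, Prop. 7.2.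
-/

noncomputable section

set_option linter.dupNamespace false

open Complex Set FirstOrder

namespace Summit.Schanuel.Schanuel.Cruxes.MinimalCounterexampleInAcl.KernelArithmeticSelection

open Literature.NumberTheory.Transcendental (SchanuelRank)
open Literature.ModelTheory.ExponentialFields
open Summit.Schanuel.Schanuel.Theorems.AclSubsetLogFreeCore.Negative

variable {n : ℕ}

/-! ## One mixed direction, every rank -/

/-- **A mixed direction with a ONE-SIDED hit set is in `acl(∅)` (every rank).**  For a ℚ-linearly independent `x : Fin n → ℂ` and an
integer vector `M` with `e^{Σ Mᵢxᵢ}` algebraic, if the hit set `{k ∈ ℤ : Σ Mᵢxᵢ + 2πik ∈ E_M}` of the value set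
`E_M = {Σ Mᵢx'ᵢ : x' ∈ locusMates x}` is bounded below or above, then `Σ Mᵢxᵢ ∈ acl^{ℂ_exp}(∅)`: bridge
(`intCombo_locusMates_definable₁`, `cexp_image_intCombo_locusMates_finite`) + one-sided selector (`stub_selectorOneSided`).
[cite: KirbyMacintyreOnshuus2012, §2] -/
theorem intCombo_mem_expAcl_of_oneSided {x : Fin n → ℂ} (hx : LinearIndependent ℚ x) (M : Fin n → ℤ)
    (halg : IsAlgebraic ℚ (cexp (∑ i, (M i : ℂ) * x i)))
    (hside : BddBelow {k : ℤ | (∑ i, (M i : ℂ) * x i) + 2 * ↑Real.pi * I * (k : ℂ) ∈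
        {s : ℂ | ∃ x' ∈ locusMates x, s = ∑ i, (M i : ℂ) * x' i}} ∨
      BddAbove {k : ℤ | (∑ i, (M i : ℂ) * x i) + 2 * ↑Real.pi * I * (k : ℂ) ∈
        {s : ℂ | ∃ x' ∈ locusMates x, s = ∑ i, (M i : ℂ) * x' i}}) :
    (∑ i, (M i : ℂ) * x i) ∈ expAcl :=
  stub_selectorOneSided _ _ (intCombo_locusMates_definable₁ x M) (cexp_image_intCombo_locusMates_finite x M halg)
    ⟨x, self_mem_locusMates x hx, rfl⟩ hside

/-- **The dichotomy for a mixed direction (every rank)**: `Σ Mᵢxᵢ ∈ acl(∅)`, or its hit set is unbounded below AND above.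
[cite: KirbyMacintyreOnshuus2012, §2] -/
theorem intCombo_mem_expAcl_or_hits_unbounded {x : Fin n → ℂ} (hx : LinearIndependent ℚ x) (M : Fin n → ℤ)
    (halg : IsAlgebraic ℚ (cexp (∑ i, (M i : ℂ) * x i))) :
    (∑ i, (M i : ℂ) * x i) ∈ expAcl ∨
      (¬ BddBelow {k : ℤ | (∑ i, (M i : ℂ) * x i) + 2 * ↑Real.pi * I * (k : ℂ) ∈
          {s : ℂ | ∃ x' ∈ locusMates x, s = ∑ i, (M i : ℂ) * x' i}} ∧
        ¬ BddAbove {k : ℤ | (∑ i, (M i : ℂ) * x i) + 2 * ↑Real.pi * I * (k : ℂ) ∈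
          {s : ℂ | ∃ x' ∈ locusMates x, s = ∑ i, (M i : ℂ) * x' i}}) := by
  by_cases h : BddBelow {k : ℤ | (∑ i, (M i : ℂ) * x i) + 2 * ↑Real.pi * I * (k : ℂ) ∈
        {s : ℂ | ∃ x' ∈ locusMates x, s = ∑ i, (M i : ℂ) * x' i}} ∨
      BddAbove {k : ℤ | (∑ i, (M i : ℂ) * x i) + 2 * ↑Real.pi * I * (k : ℂ) ∈
        {s : ℂ | ∃ x' ∈ locusMates x, s = ∑ i, (M i : ℂ) * x' i}}
  · exact Or.inl (intCombo_mem_expAcl_of_oneSided hx M halg h)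
  · exact Or.inr (not_or.1 h)

/-- **A mixed direction with FINITE WINDOW RECURRENCE is in `acl(∅)` (every rank).**  If windows of hits of every length `≥ L` recur at
finitely many places on the value set `E_M` (the shape of `windowRecurrence_e0` at rank 2), then `Σ Mᵢxᵢ ∈ acl(∅)`: when the hit set of
`Σ Mᵢxᵢ` is finite the one-sided selector applies; otherwise it contains a window of length `L + 1`, which (and whose mirror image)
recurs finitely often, and the window selector (`stub_selectorWindow`) applies.  The proof is the rank-2 argument of `rankTwo_mixed_e0`
with the curve-specific recurrence theorem turned into a hypothesis. [cite: KirbyMacintyreOnshuus2012, §2] -/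
theorem intCombo_mem_expAcl_of_windowRecurrence {x : Fin n → ℂ} (hx : LinearIndependent ℚ x) (M : Fin n → ℤ)
    (halg : IsAlgebraic ℚ (cexp (∑ i, (M i : ℂ) * x i)))
    (hrec : ∃ L : ℕ, ∀ G : Finset ℤ, L ≤ G.card →
      Set.Finite {s : ℂ | ∀ g ∈ G, s + 2 * ↑Real.pi * I * (g : ℂ) ∈
        {s : ℂ | ∃ x' ∈ locusMates x, s = ∑ i, (M i : ℂ) * x' i}}) :
    (∑ i, (M i : ℂ) * x i) ∈ expAcl := by
  classical
  set u : ℂ := ∑ i, (M i : ℂ) * x i with hu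
  set E : Set ℂ := {s : ℂ | ∃ x' ∈ locusMates x, s = ∑ i, (M i : ℂ) * x' i} with hE
  have hEdef : Set.Definable₁ (∅ : Set ℂ) Language.expRing E := intCombo_locusMates_definable₁ x M
  have hEfin : (cexp '' E).Finite := cexp_image_intCombo_locusMates_finite x M halg
  have huE : u ∈ E := ⟨x, self_mem_locusMates x hx, rfl⟩
  set K : Set ℤ := {k : ℤ | u + 2 * ↑Real.pi * I * (k : ℂ) ∈ E} with hK
  by_cases hKfin : K.Finite
  · exact stub_selectorOneSided E u hEdef hEfin huE (Or.inl hKfin.bddBelow)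
  · obtain ⟨L, hL⟩ := hrec
    have hKinf : K.Infinite := hKfin
    obtain ⟨F, hFK, hFcard⟩ := hKinf.exists_subset_card_eq (L + 1)
    have hFne : F.Nonempty := Finset.card_pos.1 (by omega)
    set k₀ : ℤ := F.min' hFne with hk₀
    set G : Finset ℤ := F.image (fun k => k - k₀) with hG
    have hk₀F : k₀ ∈ F := F.min'_mem hFne
    have h0G : (0 : ℤ) ∈ G := Finset.mem_image.2 ⟨k₀, hk₀F, sub_self _⟩
    have hGcard : G.card = F.card := Finset.card_image_of_injective _ sub_left_injective
    have hwin : ∀ g ∈ G, u + 2 * ↑Real.pi * I * ((k₀ + g : ℤ) : ℂ) ∈ E := by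
      intro g hg
      obtain ⟨k, hkF, rfl⟩ := Finset.mem_image.1 hg
      have hk : k₀ + (k - k₀) = k := by ring
      rw [hk]
      exact hFK (Finset.mem_coe.2 hkF)
    have hfinP : Set.Finite {s : ℂ | ∀ g ∈ G, s + 2 * ↑Real.pi * I * (g : ℂ) ∈ E} :=
      hL G (by rw [hGcard, hFcard]; omega)
    have hfinN : Set.Finite {s : ℂ | ∀ g ∈ G, s - 2 * ↑Real.pi * I * (g : ℂ) ∈ E} := by
      have h := hL (G.image Neg.neg)
        (by rw [Finset.card_image_of_injective _ neg_injective, hGcard, hFcard]; omega)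
      refine h.subset ?_
      intro s hs g hg
      obtain ⟨g', hg', rfl⟩ := Finset.mem_image.1 hg
      have h' := hs g' hg'
      simp only [Int.cast_neg, mul_neg, ← sub_eq_add_neg]
      exact h'
    exact stub_selectorWindow E u G k₀ hEdef h0G hwin hfinP hfinN

/-! ## The corank-one mixed sector, every rank -/

/-- **(S*) ON THE CORANK-ONE MIXED SECTOR WITH ONE-SIDED HIT SETS (every rank).**  At a first failure `x` of rank `n = m + 1`, if `m`
ℚ-linearly independent integer combinations `u_k = Σᵢ M_{ki} xᵢ` have algebraic exponentials and each hit set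
`{j ∈ ℤ : u_k + 2πij ∈ E_{M_k}}` is bounded on one side, then every `xᵢ ∈ acl^{ℂ_exp}(∅)`: each `u_k ∈ acl(∅)` by the one-sided
selector, and `m = n − 1` independent combinations in `acl(∅)` force all coordinates (`firstFailure_mem_expAcl_of_intCombos`, via
`SchanuelRank (n − 1)`). [cite: Kirby2010, Prop. 7.2] -/
theorem mem_expAcl_of_corankOne_oneSided {x : Fin n → ℂ} (hx : x ∈ firstFailures n) {m : ℕ} (hmn : n = m + 1)
    (M : Fin m → Fin n → ℤ) (hli : LinearIndependent ℚ (fun k => ∑ i, (M k i : ℂ) * x i))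
    (halg : ∀ k, IsAlgebraic ℚ (cexp (∑ i, (M k i : ℂ) * x i)))
    (hside : ∀ k, BddBelow {j : ℤ | (∑ i, (M k i : ℂ) * x i) + 2 * ↑Real.pi * I * (j : ℂ) ∈
        {s : ℂ | ∃ x' ∈ locusMates x, s = ∑ i, (M k i : ℂ) * x' i}} ∨
      BddAbove {j : ℤ | (∑ i, (M k i : ℂ) * x i) + 2 * ↑Real.pi * I * (j : ℂ) ∈
        {s : ℂ | ∃ x' ∈ locusMates x, s = ∑ i, (M k i : ℂ) * x' i}}) :
    ∀ i, x i ∈ expAcl :=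
  firstFailure_mem_expAcl_of_intCombos hx hmn M hli fun k =>
    intCombo_mem_expAcl_of_oneSided hx.1 (M k) (halg k) (hside k)

/-- **(S*) ON THE CORANK-ONE MIXED SECTOR FROM WINDOW-RECURRENCE FINITENESS (every rank).**  At a first failure `x` of rank `n = m + 1`
with `m` ℚ-independent mixed directions `M_k` (algebraic exponentials), finite window recurrence on each value set `E_{M_k}` puts every
coordinate of `x` in `acl^{ℂ_exp}(∅)` — this is the exact every-rank analogue of `rankTwo_mixed_e0`, with the curve-specific theorem
`windowRecurrence_e0` replaced by the hypothesis `hrec` (the open input for item 14744's mixed sectors). [cite: Kirby2010, Prop. 7.2] -/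
theorem mem_expAcl_of_corankOne_windowRecurrence {x : Fin n → ℂ} (hx : x ∈ firstFailures n) {m : ℕ} (hmn : n = m + 1)
    (M : Fin m → Fin n → ℤ) (hli : LinearIndependent ℚ (fun k => ∑ i, (M k i : ℂ) * x i))
    (halg : ∀ k, IsAlgebraic ℚ (cexp (∑ i, (M k i : ℂ) * x i)))
    (hrec : ∀ k, ∃ L : ℕ, ∀ G : Finset ℤ, L ≤ G.card →
      Set.Finite {s : ℂ | ∀ g ∈ G, s + 2 * ↑Real.pi * I * (g : ℂ) ∈
        {s : ℂ | ∃ x' ∈ locusMates x, s = ∑ i, (M k i : ℂ) * x' i}}) :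
    ∀ i, x i ∈ expAcl :=
  firstFailure_mem_expAcl_of_intCombos hx hmn M hli fun k =>
    intCombo_mem_expAcl_of_windowRecurrence hx.1 (M k) (halg k) (hrec k)

/-- **Coordinate form (every rank).**  If `e^{x_k}` is algebraic for all `k ≠ i₀` (all coordinates but one are logarithms of algebraic
numbers) and each of those `n − 1` coordinate hit sets has finite window recurrence, then (S*) holds at the first failure `x`.
[cite: Kirby2010, Prop. 7.2] -/
theorem mem_expAcl_of_allButOne_algebraic_windowRecurrence {m : ℕ} {x : Fin (m + 1) → ℂ} (hx : x ∈ firstFailures (m + 1))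
    (i₀ : Fin (m + 1)) (halg : ∀ k : Fin m, IsAlgebraic ℚ (cexp (x (i₀.succAbove k))))
    (hrec : ∀ k : Fin m, ∃ L : ℕ, ∀ G : Finset ℤ, L ≤ G.card →
      Set.Finite {s : ℂ | ∀ g ∈ G, s + 2 * ↑Real.pi * I * (g : ℂ) ∈
        {s : ℂ | ∃ x' ∈ locusMates x, s = ∑ i, ((Pi.single (i₀.succAbove k) (1 : ℤ) : Fin (m + 1) → ℤ) i : ℂ) * x' i}}) :
    ∀ i, x i ∈ expAcl := by
  classical
  -- the coordinate directions `e_{succAbove k}`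
  set M : Fin m → Fin (m + 1) → ℤ := fun k => Pi.single (i₀.succAbove k) (1 : ℤ) with hM
  have hsum : ∀ (k : Fin m) (z : Fin (m + 1) → ℂ), (∑ i, (M k i : ℂ) * z i) = z (i₀.succAbove k) := by
    intro k z
    rw [Finset.sum_eq_single (i₀.succAbove k)]
    · simp [hM]
    · intro b _ hb
      simp [hM, hb]
    · intro h; exact absurd (Finset.mem_univ _) h
  have hli : LinearIndependent ℚ (fun k => ∑ i, (M k i : ℂ) * x i) := by
    have e : (fun k => ∑ i, (M k i : ℂ) * x i) = x ∘ i₀.succAbove := funext fun k => hsum k x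
    rw [e]
    exact hx.1.comp _ Fin.succAbove_right_injective
  refine mem_expAcl_of_corankOne_windowRecurrence hx rfl M hli (fun k => by rw [hsum]; exact halg k) fun k => ?_
  obtain ⟨L, hL⟩ := hrec k
  exact ⟨L, fun G hG => by simpa only [hM] using hL G hG⟩

/-! ## Registered form (explicit binders, fully qualified; `ledger workitem stub-add stmt-Schanuel-0969 --name stub_corankOneMixed_windowRecurrence …`) -/

/-- Registered form of `mem_expAcl_of_corankOne_windowRecurrence` (stub `stub_corankOneMixed_windowRecurrence` of crux stmt-Schanuel-0969,
line kernel-arithmetic-selection, lead c5): (S*) on the corank-one mixed sector of every rank from window-recurrence finiteness. -/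
theorem stub_corankOneMixed_windowRecurrence : ∀ (n m : ℕ) (x : Fin n → ℂ), x ∈ Summit.Schanuel.Schanuel.Cruxes.MinimalCounterexampleInAcl.KernelArithmeticSelection.firstFailures n → n = m + 1 → ∀ (M : Fin m → Fin n → ℤ), LinearIndependent ℚ (fun k => ∑ i, (M k i : ℂ) * x i) → (∀ k, IsAlgebraic ℚ (Complex.exp (∑ i, (M k i : ℂ) * x i))) → (∀ k, ∃ L : ℕ, ∀ G : Finset ℤ, L ≤ G.card → Set.Finite {s : ℂ | ∀ g ∈ G, s + 2 * ↑Real.pi * Complex.I * (g : ℂ) ∈ {s : ℂ | ∃ x' ∈ Summit.Schanuel.Schanuel.Cruxes.MinimalCounterexampleInAcl.KernelArithmeticSelection.locusMates x, s = ∑ i, (M k i : ℂ) * x' i}}) → ∀ i, x i ∈ Summit.Schanuel.Schanuel.Theorems.AclSubsetLogFreeCore.Negative.expAcl :=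
  fun _ _ _ hx hmn M hli halg hrec => mem_expAcl_of_corankOne_windowRecurrence hx hmn M hli halg hrec

end Summit.Schanuel.Schanuel.Cruxes.MinimalCounterexampleInAcl.KernelArithmeticSelection

end
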